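import Summits.QuantumFields.BalabanUV.T4Continuum.Support.NE7BlockLandauCorrectionExists
import Summits.QuantumFields.BalabanUV.T4Continuum.Support.NE3CurvedFrameKill
import Summits.QuantumFields.BalabanUV.T4Continuum.Support.NE3FramePotBoundW
import HarnessLib

/-!
# NE7HarmonicExtensionExists — THE EXISTENCE HALF OF (R-H): every skew periodic coarse datum `θ′` has a HARMONIC EXTENSION `h` at the curved background — skew, periodic,
# with prescribed nested block means `bmeanIterW L (j+1) W h = θ′` and `gaugeDir W h` `hsR`-orthogonal to `gaugeDir W ν` for every block-mean-zero gauge `ν ∈ N(Q′(W))`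
# (Bałaban's scalar minimal extension at `W`) — any extension (row NE3's `exists_bmeanIterW_eq`) plus its block-Landau correction (F172) (file 106 of the curved (APE), F176)

Cell `pub-balaban`, rung (B)+1 sub-cell t4, lineage `b2b-balaban-t4-ne7-p1` (CRUX PROVER NE7 #1 = OWNER of row NE7), generation 83; memo
`t4/b2b-balaban-t4-ne7-p1-g83/BALABAN-GAUGE-ROAD.md` §8.  Over row NE3's `NE3CurvedFrameKill.exists_bmeanIterW_eq` (the nested transported block mean is ONTO, `L^d ≥ 2`) and F172
`NE7BlockLandauCorrectionExists.exists_blockLandau_correction` BY NAME.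
WHY.  F174∕F175 display (R-H) = existence of the harmonic extension WITH its sup size `‖h‖_∞ ≤ C_H‖θ′‖_∞`.  THIS file settles the existence (so the letter's content is the SIZE
alone — the sup row of Bałaban's scalar minimal extension at curved `W`, [B4]∕[B9] §3 TYPE): take any `μ₀` with `bmeanIterW μ₀ = θ′`, correct it by `c₀ ∈ N(Q′(W))` so that
`gaugeDir W (μ₀ + c₀) ⊥ gaugeDir W N(Q′(W))`; the block means are unchanged (`bmeanIterW c₀ = 0`).
WHAT ([folklore]; 0 def, 0 sorry).  **`exists_harmonicExtension`** (`L ≥ 1`, `L^d ≥ 2`, multi-level small-field class, `θ′` skew `N`-periodic).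
HONEST FRAMING (page 1): finite-dimensional linear algebra + kinematics; NO estimate (the size is NOT proved); nothing of Bałaban's asserted; (APE) on curved data NOT proved;
NOT ONE-STEP, NOT NE7; spine 0∕9; finite T⁴ rung (B)+1 — NOT infinite volume, NOT mass gap, NOT `BetaPertH`, NOT Clay.  Continuum YM on T⁴ ⇐ BetaPertH ∧ nine spine estimates
(0/9 proved); BetaPertH ⇐ (D1) ∧ (D4) ∧ CAP+tail; G-an2-4 gates asym, D1 and NE2/3/4.
-/

set_option autoImplicit false

open scoped BigOperators Matrix Matrix.Norms.L2Operator
open NormedSpace Finset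

namespace Summit.QuantumFields.BalabanUV.T4Continuum.NE7HarmonicExtensionExists

open Literature.MathematicalPhysics.QuantumFieldTheory.Balaban1983to89
open B7Prop1Explicit B7Prop2Explicit
open T4AveragingDeficitWall (IsUnitaryCfg SmallField)
open T4AveragingDeficitWallBoundary (IsPeriodicCfg periodBox)
open AveragingDeficitMultiLevelPrep (tower LevelSmall)
open BlockAveragePushDirGauge (gaugeDir)
open NE3CovariantCalculus (hsR hsR_add_left)
open NE3TangentCovariantStructure (gaugeDir_add_fun)
open NE3CovariantBlockMean (bmeanIterW)
open NE3FrameFreeSliceW (bmeanIterW_add)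
open NE3CurvedFrameKill (exists_bmeanIterW_eq)
open NE3FramePotBoundW (tower_eq_pow_mul)
open NE3.PairLandauB8 (avgKernelGauges mem_avgKernelGauges_iff)
open NE7BlockLandauCorrectionExists (exists_blockLandau_correction)

noncomputable section

variable {d : ℕ} {n : Type*} [Fintype n] [DecidableEq n]

/-- **THE HARMONIC EXTENSION OF PRESCRIBED NESTED BLOCK MEANS EXISTS** (multi-level small-field class at `W`, level `j+1`, period `N·L^{j+1}`, `L ≥ 1`, `L^d ≥ 2`): for every
skew `N`-periodic coarse `θ′` there is a skew `(N·L^{j+1})`-periodic `h` with `bmeanIterW L (j+1) W h = θ′` whose gauge direction is `hsR`-orthogonal over the period box to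
`gaugeDir W ν` for every `ν ∈ N(Q′(W))`. [folklore] -/
theorem exists_harmonicExtension [Nonempty n] {L N : ℕ} [NeZero N] (hL : 1 ≤ L) (hLd : 2 ≤ L ^ d) (j : ℕ) {W : Site d → Fin d → (Matrix n n ℂ)ˣ} {x : ℝ}
    (hWu : IsUnitaryCfg W) (hWP : IsPeriodicCfg W ((N * L ^ (j + 1) : ℕ) : ℤ)) (hx : 0 ≤ x) (hs : LevelSmall d L j x) (hWx : SmallField W x)
    {θ' : Site d → Matrix n n ℂ} (hθs : ∀ z, θ' z ∈ skewAdjoint (Matrix n n ℂ)) (hθP : ∀ (z : Site d) (i : Fin d), θ' (z + (N : ℤ) • e i) = θ' z) :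
    ∃ h : Site d → Matrix n n ℂ, (∀ y, h y ∈ skewAdjoint (Matrix n n ℂ)) ∧
      (∀ (y : Site d) (i : Fin d), h (y + ((N * L ^ (j + 1) : ℕ) : ℤ) • e i) = h y) ∧
      bmeanIterW L (j + 1) W h = θ' ∧
      ∀ nu ∈ avgKernelGauges (d := d) (n := n) L N (j + 1) W,
        ∑ y ∈ periodBox (d := d) (N * L ^ (j + 1)), ∑ κ : Fin d, hsR (gaugeDir W h y κ) (gaugeDir W nu y κ) = 0 := by
  have hN : 1 ≤ N := Nat.one_le_iff_ne_zero.mpr (NeZero.ne N)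
  have htow : (tower L N (j + 1) : ℕ) = N * L ^ (j + 1) := by rw [tower_eq_pow_mul, Nat.mul_comm]
  have hWP' : IsPeriodicCfg W ((tower L N (j + 1) : ℕ) : ℤ) := by rw [htow]; exact hWP
  -- any extension
  obtain ⟨μ₀, hμ₀s, hμ₀P', -, hμ₀m⟩ := exists_bmeanIterW_eq hL hLd j hWu hWP' hx hs hWx hθs hθP
  have hμ₀P : ∀ (y : Site d) (i : Fin d), μ₀ (y + ((N * L ^ (j + 1) : ℕ) : ℤ) • e i) = μ₀ y := by rw [← htow]; exact hμ₀P'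
  -- its block-Landau correction
  obtain ⟨c₀, hc₀, hc₀L⟩ := exists_blockLandau_correction hL hN j hWu hWP hx hs hWx (gaugeDir W μ₀)
  obtain ⟨hc₀s, hc₀P, hc₀m⟩ := mem_avgKernelGauges_iff.mp hc₀
  refine ⟨fun y => μ₀ y + c₀ y, fun y => (skewAdjoint (Matrix n n ℂ)).add_mem (hμ₀s y) (hc₀s y),
    fun y i => by simp only [hμ₀P y i, hc₀P y i], ?_, fun nu hnu => ?_⟩
  · have h1 : (fun y => μ₀ y + c₀ y) = μ₀ + c₀ := rfl
    rw [h1, bmeanIterW_add, hμ₀m, hc₀m, add_zero]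
  · have h := hc₀L nu hnu
    calc ∑ y ∈ periodBox (d := d) (N * L ^ (j + 1)), ∑ κ : Fin d, hsR (gaugeDir W (fun y' => μ₀ y' + c₀ y') y κ) (gaugeDir W nu y κ)
        = ∑ y ∈ periodBox (d := d) (N * L ^ (j + 1)), ∑ κ : Fin d, hsR (gaugeDir W μ₀ y κ + gaugeDir W c₀ y κ) (gaugeDir W nu y κ) := by
          refine Finset.sum_congr rfl fun y _ => Finset.sum_congr rfl fun κ _ => by rw [gaugeDir_add_fun]
      _ = 0 := h

end

end Summit.QuantumFields.BalabanUV.T4Continuum.NE7HarmonicExtensionExists
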